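import Mathlib
import HarnessLib
import Literature.NumberTheory.DiophantineGeometry.AbcWave0

/-!
# Shared-atom comparison for near-residue-free tables

Registered stub of crux stmt-ABC-14354, line SketchIdeator1: two `κ`-balanced abc-triples whose
exponent triples agree on a common set `S` of prime factors have partial receptacle sums over `S`
differing by at most `K · #S`, for any table that is near-residue-free with slack `K`.
-/

-- `Summit.<Summit>.<Problem>` is the mandated summit-side namespace (CONVENTIONS §2); for the
-- single-conjunct summit `ABC` the two coincide, so the duplicate `ABC.ABC` is deliberate.
set_option linter.dupNamespace false

namespace Summit.ABC.ABC.Theorems.TameLocalReceptacle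

open Literature.NumberTheory.DiophantineGeometry

/-- Shared atoms of a near-residue-free table (inline form, `NearResidueFree κ K t` and
`IsBalanced κ` unfolded): if a table `t(p; i,j,k; r,s,z)` changes by at most `K` between any two
occurring data at the same prime with the same exponent triple (hypothesis `hN`), and two
`κ`-balanced abc-triples `(a,b,c)`, `(a',b',c')` have the same exponent triple at every prime of a
common set `S` of prime factors, then the two partial receptacle sums over `S` differ by at most
`K · #S` — termwise both data occur (in these very triples), so `hN` applies, and the termwise
bounds add up (`|∑| ≤ ∑ |·|`). [folklore] -/
theorem stub_sharedAtoms_le {κ K : ℝ} (t : ℕ → ℕ → ℕ → ℕ → ℕ → ℕ → ℕ → ℤ)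
    (hN : ∀ (p i j k r s z r' s' z' : ℕ), p.Prime →
      (∃ a b c : ℕ, (IsABCTriple a b c ∧ κ * (c : ℝ) ≤ (a : ℝ) ∧ κ * (c : ℝ) ≤ (b : ℝ)) ∧
        p ∈ (a * b * c).primeFactors ∧
        (a.factorization p, b.factorization p, c.factorization p, a / p ^ a.factorization p % p,
          b / p ^ b.factorization p % p, c / p ^ c.factorization p % p) = (i, j, k, r, s, z)) →
      (∃ a b c : ℕ, (IsABCTriple a b c ∧ κ * (c : ℝ) ≤ (a : ℝ) ∧ κ * (c : ℝ) ≤ (b : ℝ)) ∧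
        p ∈ (a * b * c).primeFactors ∧
        (a.factorization p, b.factorization p, c.factorization p, a / p ^ a.factorization p % p,
          b / p ^ b.factorization p % p, c / p ^ c.factorization p % p) = (i, j, k, r', s', z')) →
      |(t p i j k r s z : ℝ) - (t p i j k r' s' z' : ℝ)| ≤ K)
    {a b c a' b' c' : ℕ}
    (h : IsABCTriple a b c ∧ κ * (c : ℝ) ≤ (a : ℝ) ∧ κ * (c : ℝ) ≤ (b : ℝ))
    (h' : IsABCTriple a' b' c' ∧ κ * (c' : ℝ) ≤ (a' : ℝ) ∧ κ * (c' : ℝ) ≤ (b' : ℝ))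
    (S : Finset ℕ) (hS : S ⊆ (a * b * c).primeFactors) (hS' : S ⊆ (a' * b' * c').primeFactors)
    (hexp : ∀ p ∈ S, a.factorization p = a'.factorization p ∧ b.factorization p = b'.factorization p ∧
      c.factorization p = c'.factorization p) :
    |(∑ p ∈ S, (t p (a.factorization p) (b.factorization p) (c.factorization p)
        (a / p ^ a.factorization p % p) (b / p ^ b.factorization p % p)
        (c / p ^ c.factorization p % p) : ℝ)) -
      ∑ p ∈ S, (t p (a'.factorization p) (b'.factorization p) (c'.factorization p)
        (a' / p ^ a'.factorization p % p) (b' / p ^ b'.factorization p % p)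
        (c' / p ^ c'.factorization p % p) : ℝ)| ≤ K * S.card := by
  -- termwise: both data occur (witnessed by the two triples themselves) with the same exponents
  have hterm : ∀ p ∈ S, |(t p (a.factorization p) (b.factorization p) (c.factorization p)
      (a / p ^ a.factorization p % p) (b / p ^ b.factorization p % p)
      (c / p ^ c.factorization p % p) : ℝ) -
      (t p (a'.factorization p) (b'.factorization p) (c'.factorization p)
        (a' / p ^ a'.factorization p % p) (b' / p ^ b'.factorization p % p)
        (c' / p ^ c'.factorization p % p) : ℝ)| ≤ K := by
    intro p hp
    obtain ⟨e1, e2, e3⟩ := hexp p hp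
    have key := hN p (a.factorization p) (b.factorization p) (c.factorization p)
      (a / p ^ a.factorization p % p) (b / p ^ b.factorization p % p)
      (c / p ^ c.factorization p % p) (a' / p ^ a'.factorization p % p)
      (b' / p ^ b'.factorization p % p) (c' / p ^ c'.factorization p % p)
      (Nat.prime_of_mem_primeFactors (hS hp)) ⟨a, b, c, h, hS hp, rfl⟩
      ⟨a', b', c', h', hS' hp, by rw [e1, e2, e3]⟩
    rw [← e1, ← e2, ← e3] at key ⊢
    exact key
  -- sum the termwise bounds
  rw [← Finset.sum_sub_distrib]
  refine (Finset.abs_sum_le_sum_abs _ _).trans ((Finset.sum_le_sum hterm).trans_eq ?_)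
  rw [Finset.sum_const, nsmul_eq_mul, mul_comm]

end Summit.ABC.ABC.Theorems.TameLocalReceptacle
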